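import Summits.CriticalPhenomena.PercolationContinuityZ3.Theorems.PercNearOneGluingNoHeavyLowerTailSahiSwitchFactoredSplit
import Mathlib.Algebra.BigOperators.Ring.Finset
import Mathlib.Algebra.Order.BigOperators.Ring.Finset
import Mathlib.Data.Real.Basic
import Mathlib.Tactic.Linarith
import Mathlib.Tactic.Ring
import Mathlib.Tactic.Positivity
import HarnessLib

/-!
# `NoHeavyLowerTail` (crux stmt-CriticalPhenomena-4575), master-family line P1 (gen 24):
# the MEASURE BRIDGE for switch-factored (SPLIT) comb certificates — a split certificate gives S₃^max at every bias

Support file (seat `prim-masterthm-p1`, gen 24; `--supports stmt-CriticalPhenomena-4575`).  Pure algebra over the cube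
`Finset (Fin n)`; no `sorry`, standard axioms.  Memo `run/shared/lean/prim/prim-masterthm/FROM-prim-masterthm-p1-g24-FACE-RULE.md`.

SETTING (`…SahiSwitchFactoredSplit`, gen 23): a labelling `lab : Finset (Fin n) → Fin 5` (cells `0 = O`, `1,2,3` petals, `4 = K`),
two- and three-copy fibres `pairFibre` / `tripleFibre`, fibre counts `pairCount` / `tripleCount`, the Gladkov comb surplus `gladkovSurplus`
(`G`), `rainbowCount` (`T`), `shiftCount` (`X̂·F`), and `SplitCertificate lab P Q`: `P + Q = G` and `T ≼ Ô·P + K̂·Q` fibrewise.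

PROVED HERE (the edge "(SPLIT) ⟹ S₃^max" of memo g23 §1, for the given system, at EVERY bias vector `p ∈ [0,1]^n`):
with `wt p x = Π_e (p_e if e ∈ x else 1 − p_e)`, `mass p X = Σ_{x∈X} wt p x` (so `κ = mass (cell 4)`, `o = mass (cell 0)`,
`c_i = mass (cell i)`),
* `strongCubicMax_of_splitCertificate`: **`SplitCertificate lab P Q → c₁c₂c₃ ≤ max(κ,o)·(κo − (c₁c₂+c₁c₃+c₂c₃))`**;
* `kernel_branch_of_splitCertificate` (`o ≤ κ ⟹ c₁c₂c₃ ≤ κ(κo − e₂)`, i.e. `Π μ(K ⊔ C_i) ≤ μ(K)²`) and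
  `outside_branch_of_splitCertificate` (`κ ≤ o ⟹ c₁c₂c₃ ≤ o(κo − e₂)`).
MECHANISM (tensor–Bernstein regrouping, three copies): `wt x · wt y · wt w = W₃(tripleFibre x y w)` (`wt_mul3`), hence
`c₁c₂c₃ = Σ_m T(m) W₃(m)` (`mass_mul3`); the certificate bounds each `T(m)`; the SHIFT BOUND `Σ_m (X̂·F)(m) W₃(m) ≤ μ(X)·ev₂(F)`
(`shift_bound`: reindex `m ↦ m − 1_x`, `wt x · W₂(a) = W₃(a + 1_x)`); and `ev₂(G) = κo − e₂` (`ev2_gladkovSurplus`, from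
`mass_mul_mass`).  So `e₃ ≤ o·ev₂(P) + κ·ev₂(Q) ≤ max(κ,o)·ev₂(P+Q) = max(κ,o)·(κo − e₂)`.  Consequently every system with a
split certificate (all 21 123 474 systems on `≤ 5` coins, gen 23; and every system certified by the face-covariant rule of gen 24)
satisfies S₃^max, hence S₃⁺, S₃ and the class law, at every product measure.  The transport to the `Set ι`-based statements
`SahiDeepCore.StrongCubicMaxNonneg` / `SunflowerOnePayer 3` is NOT in this file.
HONEST FRAMING: a bridge; (SPLIT) itself (`SwitchFactoredSplit`) and S₃^max remain OPEN. [this work]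
-/

namespace Summit.CriticalPhenomena.PercolationContinuityZ3.Theorems

namespace SahiSwitchFactored

open Finset

variable {n : ℕ}


/-- Product weight of the point `x` under the bias vector `p`: `Π_e (p_e if e ∈ x, else 1 − p_e)`. [folklore] -/
def wt (p : Fin n → ℝ) (x : Finset (Fin n)) : ℝ := ∏ e, if e ∈ x then p e else 1 - p e

/-- Mass of a set of points: `μ_p(X) = Σ_{x ∈ X} wt p x`. [folklore] -/
def mass (p : Fin n → ℝ) (X : Finset (Finset (Fin n))) : ℝ := ∑ x ∈ X, wt p x

/-- Degree-2 tensor–Bernstein weight of a 2-copy fibre: `Π_e p_e^{a_e} (1−p_e)^{2−a_e}`. [this work] -/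
def W2 (p : Fin n → ℝ) (a : Fin n → ℕ) : ℝ := ∏ e, p e ^ (a e) * (1 - p e) ^ (2 - a e)

/-- Degree-3 tensor–Bernstein weight of a 3-copy fibre: `Π_e p_e^{m_e} (1−p_e)^{3−m_e}`. [this work] -/
def W3 (p : Fin n → ℝ) (m : Fin n → ℕ) : ℝ := ∏ e, p e ^ (m e) * (1 - p e) ^ (3 - m e)

/-- Adding the indicator of a point to a fibre. [this work] -/
def shiftUp (a : Fin n → ℕ) (x : Finset (Fin n)) : Fin n → ℕ := fun e => a e + (if e ∈ x then 1 else 0)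

/-- Removing the indicator of a point from a fibre (truncated). [this work] -/
def shiftDown (m : Fin n → ℕ) (x : Finset (Fin n)) : Fin n → ℕ := fun e => if e ∈ x then m e - 1 else m e

section weights

variable (p : Fin n → ℝ)

/-- Point weights are nonnegative on the unit cube. [folklore] -/
theorem wt_nonneg (hp : ∀ e, 0 ≤ p e ∧ p e ≤ 1) (x : Finset (Fin n)) : 0 ≤ wt p x :=
  Finset.prod_nonneg fun e _ => by
    by_cases h : e ∈ x
    · rw [if_pos h]; exact (hp e).1
    · rw [if_neg h]; exact sub_nonneg.2 (hp e).2

/-- Masses are nonnegative on the unit cube. [folklore] -/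
theorem mass_nonneg (hp : ∀ e, 0 ≤ p e ∧ p e ≤ 1) (X : Finset (Finset (Fin n))) : 0 ≤ mass p X :=
  Finset.sum_nonneg fun x _ => wt_nonneg p hp x

/-- Degree-2 weights are nonnegative on the unit cube. [folklore] -/
theorem W2_nonneg (hp : ∀ e, 0 ≤ p e ∧ p e ≤ 1) (a : Fin n → ℕ) : 0 ≤ W2 p a :=
  Finset.prod_nonneg fun e _ => mul_nonneg (pow_nonneg (hp e).1 _) (pow_nonneg (sub_nonneg.2 (hp e).2) _)

/-- Degree-3 weights are nonnegative on the unit cube. [folklore] -/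
theorem W3_nonneg (hp : ∀ e, 0 ≤ p e ∧ p e ≤ 1) (m : Fin n → ℕ) : 0 ≤ W3 p m :=
  Finset.prod_nonneg fun e _ => mul_nonneg (pow_nonneg (hp e).1 _) (pow_nonneg (sub_nonneg.2 (hp e).2) _)

/-- One coordinate, two copies. [this work] -/
private theorem pick2 (t : ℝ) (b c : Prop) [Decidable b] [Decidable c] :
    (if b then t else 1 - t) * (if c then t else 1 - t) =
      t ^ ((if b then 1 else 0) + (if c then 1 else 0)) * (1 - t) ^ (2 - ((if b then 1 else 0) + (if c then 1 else 0))) := by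
  by_cases hb : b <;> by_cases hc : c <;> simp only [hb, hc, if_true, if_false] <;> norm_num <;> ring

/-- `wt x · wt y = W2 (pairFibre x y)`. [this work] -/
theorem wt_mul_wt (x y : Finset (Fin n)) : wt p x * wt p y = W2 p (pairFibre x y) := by
  unfold wt W2 pairFibre
  rw [← Finset.prod_mul_distrib]
  exact Finset.prod_congr rfl fun e _ => pick2 (p e) (e ∈ x) (e ∈ y)

/-- One coordinate: a point factor times a degree-2 weight is the degree-3 weight of the shifted digit (digit `≤ 2`). [this work] -/
private theorem pick12 (t : ℝ) (b : Prop) [Decidable b] (k : ℕ) (hk : k ≤ 2) :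
    (if b then t else 1 - t) * (t ^ k * (1 - t) ^ (2 - k)) =
      t ^ (k + (if b then 1 else 0)) * (1 - t) ^ (3 - (k + (if b then 1 else 0))) := by
  by_cases hb : b
  · simp only [hb, if_true]
    have : 3 - (k + 1) = 2 - k := by omega
    rw [this, pow_succ]; ring
  · simp only [hb, if_false, add_zero]
    have : 3 - k = (2 - k) + 1 := by omega
    rw [this, pow_succ]; ring

/-- `wt x · W2 a = W3 (shiftUp a x)` for a genuine 2-copy fibre `a` (digits `≤ 2`). [this work] -/
theorem wt_mul_W2 (x : Finset (Fin n)) (a : Fin n → ℕ) (ha : ∀ e, a e ≤ 2) :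
    wt p x * W2 p a = W3 p (shiftUp a x) := by
  unfold wt W2 W3 shiftUp
  rw [← Finset.prod_mul_distrib]
  exact Finset.prod_congr rfl fun e _ => pick12 (p e) (e ∈ x) (a e) (ha e)

/-- Digits of a pair fibre are at most `2`. [this work] -/
theorem pairFibre_le_two (x y : Finset (Fin n)) (e : Fin n) : pairFibre x y e ≤ 2 := by
  unfold pairFibre; split_ifs <;> omega

/-- `wt x · wt y · wt w = W3 (tripleFibre x y w)`. [this work] -/
theorem wt_mul3 (x y w : Finset (Fin n)) : wt p x * wt p y * wt p w = W3 p (tripleFibre x y w) := by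
  rw [wt_mul_wt, mul_comm, wt_mul_W2 p w (pairFibre x y) (pairFibre_le_two x y)]
  rfl

/-- Triple sums as sums over the product finset. [folklore] -/
private theorem sum_prod3 {β : Type*} [AddCommMonoid β] (S T W : Finset (Finset (Fin n)))
    (g : Finset (Fin n) → Finset (Fin n) → Finset (Fin n) → β) :
    ∑ q ∈ S ×ˢ T ×ˢ W, g q.1 q.2.1 q.2.2 = ∑ x ∈ S, ∑ y ∈ T, ∑ w ∈ W, g x y w := by
  simp only [Finset.sum_product]

/-- Product of two masses in the degree-2 basis (regrouped by fibre over any set `A` containing all fibres). [this work] -/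
theorem mass_mul_mass (S T : Finset (Finset (Fin n))) (A : Finset (Fin n → ℕ))
    (hA : ∀ q ∈ S ×ˢ T, pairFibre q.1 q.2 ∈ A) :
    mass p S * mass p T = ∑ a ∈ A, (pairCount S T a : ℝ) * W2 p a := by
  have h1 : ∀ a ∈ A, (pairCount S T a : ℝ) * W2 p a =
      ∑ q ∈ S ×ˢ T, if pairFibre q.1 q.2 = a then W2 p a else 0 := by
    intro a _
    rw [pairCount, Finset.card_filter, Nat.cast_sum, Finset.sum_mul]
    refine Finset.sum_congr rfl fun q _ => ?_
    split_ifs <;> simp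
  rw [Finset.sum_congr rfl h1, Finset.sum_comm]
  have h2 : ∀ q ∈ S ×ˢ T, (∑ a ∈ A, if pairFibre q.1 q.2 = a then W2 p a else 0) = wt p q.1 * wt p q.2 := by
    intro q hq
    rw [Finset.sum_ite_eq A (pairFibre q.1 q.2) (fun a => W2 p a), if_pos (hA q hq), wt_mul_wt]
  rw [Finset.sum_congr rfl h2, mass, mass, Finset.sum_mul_sum, ← Finset.sum_product']

/-- Product of three masses in the degree-3 basis, regrouped over any set `M` containing all occurring fibres. [this work] -/
theorem mass_mul3 (S T W : Finset (Finset (Fin n))) (M : Finset (Fin n → ℕ))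
    (hM : ∀ q ∈ S ×ˢ T ×ˢ W, tripleFibre q.1 q.2.1 q.2.2 ∈ M) :
    mass p S * mass p T * mass p W = ∑ m ∈ M, (tripleCount S T W m : ℝ) * W3 p m := by
  have h1 : ∀ m ∈ M, (tripleCount S T W m : ℝ) * W3 p m =
      ∑ q ∈ S ×ˢ T ×ˢ W, if tripleFibre q.1 q.2.1 q.2.2 = m then W3 p m else 0 := by
    intro m _
    rw [tripleCount, Finset.card_filter, Nat.cast_sum, Finset.sum_mul]
    refine Finset.sum_congr rfl fun q _ => ?_
    split_ifs <;> simp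
  rw [Finset.sum_congr rfl h1, Finset.sum_comm]
  have h2 : ∀ q ∈ S ×ˢ T ×ˢ W, (∑ m ∈ M, if tripleFibre q.1 q.2.1 q.2.2 = m then W3 p m else 0) =
      wt p q.1 * wt p q.2.1 * wt p q.2.2 := by
    intro q hq
    rw [Finset.sum_ite_eq M (tripleFibre q.1 q.2.1 q.2.2) (fun m => W3 p m), if_pos (hM q hq), wt_mul3]
  rw [Finset.sum_congr rfl h2, sum_prod3 S T W (fun x y w => wt p x * wt p y * wt p w)]
  simp only [mass]
  rw [Finset.sum_mul_sum, Finset.sum_mul]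
  exact Finset.sum_congr rfl fun x _ => by
    rw [Finset.sum_mul]
    exact Finset.sum_congr rfl fun y _ => by rw [Finset.mul_sum]

end weights


section bridge

variable (p : Fin n → ℝ)

/-- The set of all genuine 2-copy fibres (fibres of some pair of points). [this work] -/
def allPairFibres (n : ℕ) : Finset (Fin n → ℕ) :=
  ((univ : Finset (Finset (Fin n))) ×ˢ (univ : Finset (Finset (Fin n)))).image fun q => pairFibre q.1 q.2

/-- Every pair fibre is a genuine fibre. [this work] -/
theorem pairFibre_mem_allPairFibres (x y : Finset (Fin n)) : pairFibre x y ∈ allPairFibres n :=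
  Finset.mem_image.2 ⟨(x, y), Finset.mem_product.2 ⟨Finset.mem_univ _, Finset.mem_univ _⟩, rfl⟩

/-- Genuine 2-copy fibres have digits `≤ 2`. [this work] -/
theorem le_two_of_mem_allPairFibres {a : Fin n → ℕ} (ha : a ∈ allPairFibres n) (e : Fin n) : a e ≤ 2 := by
  obtain ⟨q, _, rfl⟩ := Finset.mem_image.1 ha
  exact pairFibre_le_two q.1 q.2 e

/-- A pair count vanishes off the genuine fibres. [this work] -/
theorem pairCount_eq_zero_of_not_mem {S T : Finset (Finset (Fin n))} {a : Fin n → ℕ} (ha : a ∉ allPairFibres n) :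
    pairCount S T a = 0 := by
  unfold pairCount
  rw [Finset.card_eq_zero, Finset.filter_eq_empty_iff]
  intro q _ h
  exact ha (h ▸ pairFibre_mem_allPairFibres q.1 q.2)

/-- The Gladkov surplus vanishes off the genuine fibres. [this work] -/
theorem gladkovSurplus_eq_zero_of_not_mem (lab : Finset (Fin n) → Fin 5) {a : Fin n → ℕ} (ha : a ∉ allPairFibres n) :
    gladkovSurplus lab a = 0 := by
  simp only [gladkovSurplus, pairCount_eq_zero_of_not_mem ha, Nat.cast_zero, add_zero, sub_zero]

/-- Evaluation of a function on 2-copy fibres against the degree-2 weights. [this work] -/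
def ev2 (F : (Fin n → ℕ) → ℕ) : ℝ := ∑ a ∈ allPairFibres n, (F a : ℝ) * W2 p a

/-- `ev₂` of a natural-valued function is nonnegative on the unit cube. [this work] -/
theorem ev2_nonneg (hp : ∀ e, 0 ≤ p e ∧ p e ≤ 1) (F : (Fin n → ℕ) → ℕ) : 0 ≤ ev2 p F :=
  Finset.sum_nonneg fun a _ => mul_nonneg (Nat.cast_nonneg _) (W2_nonneg p hp a)

/-- `shiftUp (shiftDown m x) x = m` when `1_x ≤ m`. [this work] -/
theorem shiftUp_shiftDown {m : Fin n → ℕ} {x : Finset (Fin n)} (h : ∀ e ∈ x, 1 ≤ m e) :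
    shiftUp (shiftDown m x) x = m := by
  funext e
  unfold shiftUp shiftDown
  by_cases he : e ∈ x
  · rw [if_pos he, if_pos he]; have := h e he; omega
  · rw [if_neg he, if_neg he, add_zero]

/-- **The shift bound**: `Σ_{m ∈ M} (X̂·F)(m) W₃(m) ≤ μ(X) · ev₂(F)` for `F` vanishing off the genuine fibres and ANY finite set
`M` of 3-copy fibres (equality when `M` contains all shifts; only the inequality is needed). [this work] -/
theorem shift_bound (hp : ∀ e, 0 ≤ p e ∧ p e ≤ 1) (X : Finset (Finset (Fin n))) (F : (Fin n → ℕ) → ℕ)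
    (hF : ∀ a, a ∉ allPairFibres n → F a = 0) (M : Finset (Fin n → ℕ)) :
    ∑ m ∈ M, (shiftCount X F m : ℝ) * W3 p m ≤ mass p X * ev2 p F := by
  -- expand both sides as double sums over x ∈ X
  have hR : mass p X * ev2 p F = ∑ x ∈ X, ∑ a ∈ allPairFibres n, (F a : ℝ) * W3 p (shiftUp a x) := by
    unfold mass ev2
    rw [Finset.sum_mul_sum]
    refine Finset.sum_congr rfl fun x _ => Finset.sum_congr rfl fun a ha => ?_
    rw [← wt_mul_W2 p x a (le_two_of_mem_allPairFibres ha)]; ring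
  have hL : ∑ m ∈ M, (shiftCount X F m : ℝ) * W3 p m =
      ∑ x ∈ X, ∑ m ∈ M, (if (∀ e ∈ x, 1 ≤ m e) then (F (shiftDown m x) : ℝ) else 0) * W3 p m := by
    rw [Finset.sum_comm]
    refine Finset.sum_congr rfl fun m _ => ?_
    rw [shiftCount, Nat.cast_sum, Finset.sum_mul]
    refine Finset.sum_congr rfl fun x _ => ?_
    unfold shiftDown
    split_ifs <;> simp
  rw [hR, hL]
  refine Finset.sum_le_sum fun x _ => ?_
  -- fix x: restrict to the fibres above 1_x, reindex by shiftDown, then enlarge to all genuine fibres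
  set M' := M.filter fun m => ∀ e ∈ x, 1 ≤ m e with hM'
  have h1 : ∑ m ∈ M, (if (∀ e ∈ x, 1 ≤ m e) then (F (shiftDown m x) : ℝ) else 0) * W3 p m =
      ∑ m ∈ M', (F (shiftDown m x) : ℝ) * W3 p m := by
    rw [hM', Finset.sum_filter]
    refine Finset.sum_congr rfl fun m _ => ?_
    split_ifs <;> simp
  have hinj : Set.InjOn (fun m : Fin n → ℕ => shiftDown m x) ↑M' := by
    intro m₁ hm₁ m₂ hm₂ heq
    have h₁ : ∀ e ∈ x, 1 ≤ m₁ e := (Finset.mem_filter.1 hm₁).2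
    have h₂ : ∀ e ∈ x, 1 ≤ m₂ e := (Finset.mem_filter.1 hm₂).2
    rw [← shiftUp_shiftDown h₁, ← shiftUp_shiftDown h₂]
    exact congrArg (fun a => shiftUp a x) heq
  have h2 : ∑ m ∈ M', (F (shiftDown m x) : ℝ) * W3 p m =
      ∑ a ∈ M'.image (fun m => shiftDown m x), (F a : ℝ) * W3 p (shiftUp a x) := by
    rw [Finset.sum_image hinj]
    refine Finset.sum_congr rfl fun m hm => ?_
    rw [shiftUp_shiftDown (Finset.mem_filter.1 hm).2]
  rw [h1, h2]
  -- drop the terms outside the genuine fibres (they vanish) and enlarge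
  set I := M'.image (fun m => shiftDown m x) with hI
  have h3 : ∑ a ∈ I, (F a : ℝ) * W3 p (shiftUp a x) = ∑ a ∈ I.filter (· ∈ allPairFibres n), (F a : ℝ) * W3 p (shiftUp a x) := by
    rw [Finset.sum_filter_of_ne]
    intro a _ hne
    by_contra hna
    exact hne (by rw [hF a hna, Nat.cast_zero, zero_mul])
  rw [h3]
  refine Finset.sum_le_sum_of_subset_of_nonneg (fun a ha => (Finset.mem_filter.1 ha).2) ?_
  intro a _ _
  exact mul_nonneg (Nat.cast_nonneg _) (W3_nonneg p hp _)

/-- `ev₂(G) = κ·o − (c₁c₂ + c₁c₃ + c₂c₃)`: the Gladkov surplus evaluates to Gladkov's defect in the cell masses. [this work] -/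
theorem ev2_gladkovSurplus (lab : Finset (Fin n) → Fin 5) :
    ∑ a ∈ allPairFibres n, (gladkovSurplus lab a : ℝ) * W2 p a =
      mass p (cell lab 4) * mass p (cell lab 0)
        - (mass p (cell lab 1) * mass p (cell lab 2) + mass p (cell lab 1) * mass p (cell lab 3)
            + mass p (cell lab 2) * mass p (cell lab 3)) := by
  have h := fun S T => mass_mul_mass p S T (allPairFibres n) (fun q _ => pairFibre_mem_allPairFibres q.1 q.2)
  rw [h, h, h, h, ← Finset.sum_add_distrib, ← Finset.sum_add_distrib, ← Finset.sum_sub_distrib]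
  refine Finset.sum_congr rfl fun a _ => ?_
  simp only [gladkovSurplus]
  push_cast
  ring

/-- **THE MEASURE BRIDGE.**  A split certificate of a system forces the one-payer inequality
`c₁c₂c₃ ≤ max(κ, o) · (κo − e₂)` (S₃^max in the cell masses) at EVERY bias vector `p ∈ [0,1]^n`. [this work] -/
theorem strongCubicMax_of_splitCertificate (lab : Finset (Fin n) → Fin 5) {P Q : (Fin n → ℕ) → ℕ}
    (hPQ : SplitCertificate lab P Q) (hp : ∀ e, 0 ≤ p e ∧ p e ≤ 1) :
    mass p (cell lab 1) * mass p (cell lab 2) * mass p (cell lab 3) ≤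
      max (mass p (cell lab 4)) (mass p (cell lab 0)) *
        (mass p (cell lab 4) * mass p (cell lab 0)
          - (mass p (cell lab 1) * mass p (cell lab 2) + mass p (cell lab 1) * mass p (cell lab 3)
              + mass p (cell lab 2) * mass p (cell lab 3))) := by
  obtain ⟨hsum, hcov⟩ := hPQ
  -- P and Q vanish off the genuine fibres
  have hPz : ∀ a, a ∉ allPairFibres n → P a = 0 := by
    intro a ha; have := hsum a; rw [gladkovSurplus_eq_zero_of_not_mem lab ha] at this; omega
  have hQz : ∀ a, a ∉ allPairFibres n → Q a = 0 := by
    intro a ha; have := hsum a; rw [gladkovSurplus_eq_zero_of_not_mem lab ha] at this; omega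
  set M := ((cell lab 1) ×ˢ (cell lab 2) ×ˢ (cell lab 3)).image fun q => tripleFibre q.1 q.2.1 q.2.2 with hM
  have he3 : mass p (cell lab 1) * mass p (cell lab 2) * mass p (cell lab 3) =
      ∑ m ∈ M, (rainbowCount lab m : ℝ) * W3 p m :=
    mass_mul3 p _ _ _ M (fun q hq => Finset.mem_image.2 ⟨q, hq, rfl⟩)
  have hstep : ∑ m ∈ M, (rainbowCount lab m : ℝ) * W3 p m ≤
      ∑ m ∈ M, (shiftCount (cell lab 0) P m : ℝ) * W3 p m + ∑ m ∈ M, (shiftCount (cell lab 4) Q m : ℝ) * W3 p m := by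
    rw [← Finset.sum_add_distrib]
    refine Finset.sum_le_sum fun m _ => ?_
    rw [← add_mul]
    exact mul_le_mul_of_nonneg_right (by exact_mod_cast hcov m) (W3_nonneg p hp m)
  have hO := shift_bound p hp (cell lab 0) P hPz M
  have hK := shift_bound p hp (cell lab 4) Q hQz M
  have hG : ev2 p P + ev2 p Q = mass p (cell lab 4) * mass p (cell lab 0)
      - (mass p (cell lab 1) * mass p (cell lab 2) + mass p (cell lab 1) * mass p (cell lab 3)
          + mass p (cell lab 2) * mass p (cell lab 3)) := by
    rw [← ev2_gladkovSurplus p lab, ev2, ev2, ← Finset.sum_add_distrib]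
    refine Finset.sum_congr rfl fun a _ => ?_
    rw [← hsum a]; push_cast; ring
  have hκ := mass_nonneg p hp (cell lab 4)
  have ho := mass_nonneg p hp (cell lab 0)
  have hP0 := ev2_nonneg p hp P
  have hQ0 := ev2_nonneg p hp Q
  have hmax1 : mass p (cell lab 0) * ev2 p P ≤ max (mass p (cell lab 4)) (mass p (cell lab 0)) * ev2 p P :=
    mul_le_mul_of_nonneg_right (le_max_right _ _) hP0
  have hmax2 : mass p (cell lab 4) * ev2 p Q ≤ max (mass p (cell lab 4)) (mass p (cell lab 0)) * ev2 p Q :=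
    mul_le_mul_of_nonneg_right (le_max_left _ _) hQ0
  rw [← hG, mul_add]
  linarith

/-- **Kernel branch** (comb certificate ⟹ measure): if `μ(O) ≤ μ(K)` then `c₁c₂c₃ ≤ κ·(κo − e₂)`, equivalently
`Π μ(U_i) ≤ μ(K)²` for the three members `U_i = K ⊔ C_i`. [this work] -/
theorem kernel_branch_of_splitCertificate (lab : Finset (Fin n) → Fin 5) {P Q : (Fin n → ℕ) → ℕ}
    (hPQ : SplitCertificate lab P Q) (hp : ∀ e, 0 ≤ p e ∧ p e ≤ 1) (hle : mass p (cell lab 0) ≤ mass p (cell lab 4)) :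
    mass p (cell lab 1) * mass p (cell lab 2) * mass p (cell lab 3) ≤
      mass p (cell lab 4) * (mass p (cell lab 4) * mass p (cell lab 0)
          - (mass p (cell lab 1) * mass p (cell lab 2) + mass p (cell lab 1) * mass p (cell lab 3)
              + mass p (cell lab 2) * mass p (cell lab 3))) := by
  have h := strongCubicMax_of_splitCertificate p lab hPQ hp
  rwa [max_eq_left hle] at h

/-- **Outside branch**: if `μ(K) ≤ μ(O)` then `c₁c₂c₃ ≤ o·(κo − e₂)`. [this work] -/
theorem outside_branch_of_splitCertificate (lab : Finset (Fin n) → Fin 5) {P Q : (Fin n → ℕ) → ℕ}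
    (hPQ : SplitCertificate lab P Q) (hp : ∀ e, 0 ≤ p e ∧ p e ≤ 1) (hle : mass p (cell lab 4) ≤ mass p (cell lab 0)) :
    mass p (cell lab 1) * mass p (cell lab 2) * mass p (cell lab 3) ≤
      mass p (cell lab 0) * (mass p (cell lab 4) * mass p (cell lab 0)
          - (mass p (cell lab 1) * mass p (cell lab 2) + mass p (cell lab 1) * mass p (cell lab 3)
              + mass p (cell lab 2) * mass p (cell lab 3))) := by
  have h := strongCubicMax_of_splitCertificate p lab hPQ hp
  rwa [max_eq_right hle] at h

end bridge

end SahiSwitchFactored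

end Summit.CriticalPhenomena.PercolationContinuityZ3.Theorems
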